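import Summits.PneNP.PneNP.Theorems.ConvexRankGatesConvexGateBlindExactLiftingTrianglePlaneLocalRows

/-!
# Triangle instance — plane-local factorisations: transposition, column incidence, and the two-row certificate

Support file for crux `ConvexGateBlind` (stmt-PneNP-10680), open stub `stub_exactLifting` (prover seat 3, session 15);
sequel of `…TrianglePlaneLocalRows` (row incidence).
* `addSolves_transpose` — the additive coupling condition is symmetric under transposing every atom (swap `P ↔ S`,
  `α ↔ β`, and the two domination families); hence `addSolves_col_incidence`: every column meets at least `t` atoms.
* `triangle_planeLocal_twoRows` (registered stub) — the TWO-ROW CERTIFICATE: for a non-negative dictionary satisfying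
  `AddSolves` and rows `a ≠ a'`, no non-zero `u` with `Σ u = 0` is orthogonal to all row differences `h(a,·) − h(a',·)`.
  (At the pair `({a}, {u > 0})` the difference `g = X₀(a,·) − X₀(a',·)` is `> α a` on `S` and `< α a` off `S`, so
  `0 = Σ u·g > α a · Σ u = 0`.)  Equivalently every doubly balanced matrix supported on two rows is ADD-certifiable, an
  entirely certifiable subspace of dimension `t − 1` per row pair; so an entirely non-certifiable subspace of the doubly
  balanced matrices has dimension `≤ (t−1)(t−2)` and a solving dictionary spans `≥ 3t − 3` dimensions
  (memo `PLANELOCAL-seat3.md` §8(d)).  Nothing here is cited; everything is elementary.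
-/

set_option linter.dupNamespace false -- `Summit.PneNP.PneNP.…`: summit = sub-problem (D-0017)

namespace Summit.PneNP.PneNP.Theorems.XorDoor.TriLine

open Finset

variable {t : ℕ}

/-- `AddSolves` is invariant under transposing every atom. -/
theorem addSolves_transpose {ι : Type} [Fintype ι] {H : ι → Fin t → Fin t → ℝ} (hA : AddSolves H) :
    AddSolves (fun i a d => H i d a) := by
  intro P S hP₁ hP₂ hS₁ hS₂
  obtain ⟨c₀, c₁, α, β, hc₀, hc₁, hadd, hαP, hαN, hβP, hβN, hdomB, hdomC⟩ := hA S P hS₁ hS₂ hP₁ hP₂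
  refine ⟨c₀, c₁, β, α, hc₀, hc₁, fun a d => by rw [hadd d a]; ring, hβP, hβN, hαP, hαN,
    fun a d ha hd => hdomC d a hd ha, fun a d ha hd => hdomB d a hd ha⟩

/-- **Column incidence.**  Every column of a non-negative dictionary satisfying `AddSolves` (`2 ≤ t`) meets at least `t`
atoms. -/
theorem addSolves_col_incidence {ι : Type} [Fintype ι] [DecidableEq ι] {H : ι → Fin t → Fin t → ℝ}
    (hH : ∀ i a d, 0 ≤ H i a d) (hA : AddSolves H) (ht : 2 ≤ t) (d : Fin t) :
    t ≤ ((univ : Finset ι).filter (fun i => ∃ a, H i a d ≠ 0)).card :=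
  addSolves_row_incidence (H := fun i a d => H i d a) (fun i a d => hH i d a) (addSolves_transpose hA) ht d

/-- **Two-row certificate.**  For rows `a ≠ a'` of a non-negative dictionary satisfying `AddSolves`, a vector `u` with
`Σ u = 0` that is orthogonal to every row difference `h(a,·) − h(a',·)` vanishes. -/
theorem addSolves_twoRow_relation {ι : Type} [Fintype ι] {H : ι → Fin t → Fin t → ℝ} (hH : ∀ i a d, 0 ≤ H i a d)
    (hA : AddSolves H) {a a' : Fin t} (ha : a' ≠ a) (u : Fin t → ℝ) (hu : ∑ d, u d = 0)
    (hrel : ∀ i, ∑ d, u d * (H i a d - H i a' d) = 0) : ∀ d, u d = 0 := by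
  classical
  -- if u ≠ 0 it has entries of both signs
  by_contra hne
  push Not at hne
  obtain ⟨d₀, hd₀⟩ := hne
  have hsigns : (∃ d, 0 < u d) ∧ (∃ d, u d < 0) := by
    by_contra hnot
    rw [not_and_or] at hnot
    rcases hnot with hp | hn
    · push Not at hp
      -- all u ≤ 0 with sum 0 ⇒ u = 0
      have hterm : ∀ d ∈ (univ : Finset (Fin t)), 0 ≤ -u d := fun d _ => by linarith [hp d]
      have hsum : ∑ d, -u d = 0 := by rw [sum_neg_distrib, hu, neg_zero]
      have := (sum_eq_zero_iff_of_nonneg hterm).mp hsum d₀ (mem_univ _)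
      exact hd₀ (by linarith)
    · push Not at hn
      have hterm : ∀ d ∈ (univ : Finset (Fin t)), 0 ≤ u d := fun d _ => hn d
      have := (sum_eq_zero_iff_of_nonneg hterm).mp hu d₀ (mem_univ _)
      exact hd₀ this
  obtain ⟨⟨d₁, hd₁⟩, ⟨d₂, hd₂⟩⟩ := hsigns
  -- the pair ({a}, {u > 0})
  obtain ⟨c₀, c₁, α, β, hc₀, hc₁, hadd, -, -, hβP, -, hdomB, hdomC⟩ :=
    hA (fun x => decide (x = a)) (fun y => decide (0 < u y)) ⟨a, by simp⟩ ⟨a', by simp [ha]⟩ ⟨d₁, by simp [hd₁]⟩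
      ⟨d₂, by simp [not_lt.mpr hd₂.le]⟩
  set g : Fin t → ℝ := fun d => (∑ i, c₀ i * H i a d) - ∑ i, c₀ i * H i a' d with hg
  have hup : ∀ d, 0 < u d → α a < g d := by
    intro d hd
    have h1 : 0 ≤ ∑ i, c₁ i * H i a d := sum_nonneg fun i _ => mul_nonneg (hc₁ i) (hH i a d)
    have h2 := hadd a d
    have h3 := hβP d (by simp [hd])
    have h4 : ∑ i, c₀ i * H i a' d < β d := hdomC a' d (by simp [ha]) (by simp [hd])
    simp only [hg]
    linarith
  have hdown : ∀ d, ¬ 0 < u d → g d < α a := by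
    intro d hd
    have h1 : ∑ i, c₀ i * H i a d < α a := hdomB a d (by simp) (by simp [hd])
    have h2 : 0 ≤ ∑ i, c₀ i * H i a' d := sum_nonneg fun i _ => mul_nonneg (hc₀ i) (hH i a' d)
    simp only [hg]
    linarith
  -- pairing: Σ_d u_d g(d) = 0
  have hpair : ∑ d, u d * g d = 0 := by
    calc ∑ d, u d * g d = ∑ d, ∑ i, c₀ i * (u d * (H i a d - H i a' d)) := by
          refine sum_congr rfl fun d _ => ?_
          simp only [hg]
          rw [← sum_sub_distrib, mul_sum]
          exact sum_congr rfl fun i _ => by ring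
      _ = ∑ i, c₀ i * ∑ d, u d * (H i a d - H i a' d) := by
          rw [sum_comm]
          exact sum_congr rfl fun i _ => (mul_sum _ _ _).symm
      _ = 0 := by simp [hrel]
  have hle : ∀ d ∈ (univ : Finset (Fin t)), u d * α a ≤ u d * g d := by
    intro d _
    by_cases hd : 0 < u d
    · exact mul_le_mul_of_nonneg_left (hup d hd).le hd.le
    · exact mul_le_mul_of_nonpos_left (hdown d hd).le (not_lt.mp hd)
  have hlt : ∃ d ∈ (univ : Finset (Fin t)), u d * α a < u d * g d :=
    ⟨d₁, mem_univ _, mul_lt_mul_of_pos_left (hup d₁ hd₁) hd₁⟩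
  have hsum := sum_lt_sum hle hlt
  rw [hpair, ← sum_mul, hu, zero_mul] at hsum
  exact lt_irrefl _ hsum

/-- Registered form (stub `triangle_planeLocal_twoRows` of stmt-PneNP-10680): the two-row certificate — doubly balanced
matrices supported on two rows are never orthogonal to a non-negative dictionary satisfying the additive coupling condition. -/
theorem triangle_planeLocal_twoRows : ∀ {t : ℕ} {ι : Type} [Fintype ι] {H : ι → Fin t → Fin t → ℝ}, (∀ i a d, 0 ≤ H i a d) → AddSolves H → ∀ (a a' : Fin t), a' ≠ a → ∀ (u : Fin t → ℝ), ∑ d, u d = 0 → (∀ i, ∑ d, u d * (H i a d - H i a' d) = 0) → ∀ d, u d = 0 :=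
  fun hH hA _ _ ha u hu hrel => addSolves_twoRow_relation hH hA ha u hu hrel

end Summit.PneNP.PneNP.Theorems.XorDoor.TriLine
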